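/-
COR-CM (cell pub-hodgecm2, stage 2 of the Hodge ladder) — junction B01 `PerLFace_of_PerL`, sequel «UisoInflationRec» of
`HOME/b01/ROUTES-B01.md` (§7 L1-C ≡ L2-B «inflation identity on `Uiso`»): the properties `Universe.GeneratorInflation` /
`Universe.UisoInflation` (typed by the ideation seat planner-pub-hodgecm2-b01-idea-2-0, `HOME/b01/IDEA-2-Sketch.lean` §3.3)
and their PROOF on the model universe (`Model.universeOf_generatorInflation`, `Model.generatorInflation_rec`) from the tree
Literature brick `CommonReflexSinglePullback` (b01 g39 CR-PORT F3, p252040: Shimura 1998 §6.2 Thm 3 inflation at the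
eigen-line level) + Riemann's theorem `deligneMilne1982_Thm_6_20_full_holds` + M14 `Model.universeOf_fact_alphaLine`.
PROOF AUTHORED by prover-pub-hodgecm2-b01-g39-0 (staged bytes `HOME/pub-hodgecm2-b01/work-CR-PORT/UisoInflationRec.lean`, md5
cefc8257d8b8, farm rc 0 as a concatenation); FILED (this header added; `variable` binders written explicitly; docstrings tagged) by the single owner of B01,
prover-pub-hodgecm2-own-b01-0.  These two Props are PROPERTIES PROVED of U_rec (not displayed residuals): a discharger of the
B01 leaves may therefore assume WLOG a PRIMITIVE corner type over a subfield `K₀ ⊊ F` (stage-1 row shape), e.g. at the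
imaginary-quadratic core of the induced slot of a degree-6 face (`Face.psi_exists_eq_inducedCMType`,
`CorCM/B01/InducedPeriodType.lean`).  Two definitions + theorems; nothing cited as a record; nothing asserted.
-/
import Literature.AlgebraicGeometry.ComplexMultiplication.CommonReflexSinglePullback
import Literature.AlgebraicGeometry.HodgeTheory.AbelianVarietyHodgeFullnessHolds
import Summits.HodgeConjecture.CorCM.Model.PerLConeFacts
import HarnessLib

/-!
# B01: inflation of isotypic one-forms on the model universe (`GeneratorInflation`, `UisoInflation`)

For a CM field `K₀` with CM type `Φ₀`, a ring map `k : K₀ → F` into a CM field `F`, the induced type `Φ₀^F = inducedCMType k Φ₀`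
and `σ : F → ℂ`: on the model universe `Model.universeOf hHD hI hU h₃` (hence on `Model.picardCMUniverse`), every pull-back
`G^*α₀` of a holomorphic `(σ ∘ k)`-eigen one-form `α₀` of `A_{(K₀,Φ₀)}` along `G : P_Γ → A_{(K₀,Φ₀)}` equals a pull-back `G'^*α`
of a holomorphic `σ`-eigen one-form `α` of `A_{(F,Φ₀^F)}` along `G' := G ≫ s`, where `s : A_{(K₀,Φ₀)} → A_{(F,Φ₀^F)}` is the
single pull-back morphism of the tree brick `CommonReflexSinglePullback` (`exists_hom_eq_pull_of_mem_eigenline_coded`: Shimura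
1998 §6.2 Thm 3 read on `σ`-eigenlines, through Riemann's theorem `deligneMilne1982_Thm_6_20_full_holds`); the holomorphic
lines on both sides are the full eigenlines by M14 `Model.universeOf_fact_alphaLine` (`σ ∈ Φ₀^F ↔ σ ∘ k ∈ Φ₀`,
`mem_inducedCMType_iff`), and `α₀ = 0` in the other case.  Hence `U.Uiso Γ K₀ Φ₀ (σ ∘ k) ≤ U.Uiso Γ F Φ₀^F σ`
(`Model.universeOf_uisoInflation`).  Statements `Universe.GeneratorInflation` / `Universe.UisoInflation` typed by the
ideation seat pub-hodgecm2-b01-idea-2 (IDEA-2 §3.3); proof by pub-hodgecm2-b01 g39 (CR-PORT probe); filed by own-b01.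
-/

noncomputable section

open scoped TensorProduct
open NumberField CategoryTheory Module

namespace Summit.HodgeConjecture.CorCM

open Literature.AlgebraicGeometry.Motives (CMType AbelianVariety bettiCohomology)
open Literature.AlgebraicGeometry.HodgeTheory
open Literature.AlgebraicGeometry.HodgeTheory.BettiUniverse (pull pull_comp cmAction IsInducedOnIntegers)
open Literature.AlgebraicGeometry.ComplexMultiplication (IsCMTypeRealisation)
open Literature.AlgebraicGeometry.ComplexMultiplication.CommonReflex
open Literature.NumberTheory.Automorphic.PicardCM
open Literature.NumberTheory.ComplexMultiplication (inducedCMType mem_inducedCMType_iff)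

/-- **Generator-level inflation** on a universe (typed by b01-idea-2, `HOME/b01/IDEA-2-Sketch.lean` §3.3): every pull-back `G^*α₀` of a holomorphic `(σ ∘ k)`-eigen one-form of `A_{(K₀,Φ₀)}` is a pull-back `G'^*α` of a holomorphic `σ`-eigen one-form of `A_{(F, Φ₀^F)}` — a PROPERTY proved below for the model universe, not a displayed input. [folklore] -/
def Universe.GeneratorInflation (U : Universe) : Prop :=
  ∀ (K₀ F : CMField) (k : K₀ →+* F) (Φ₀ : CMType K₀) (σ : F →+* ℂ)
    {L : CMField} {ι₁ : L →+* ℂ} {V : HermSpace3 L ι₁} (Γ : Level V)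
    (G : U.Mor (U.pms L ι₁ V Γ) (U.cmAV K₀ Φ₀)) (α₀ : U.CohC (U.cmAV K₀ Φ₀) 1),
    α₀ ∈ U.alphaLine K₀ Φ₀ (σ.comp k) →
    ∃ (G' : U.Mor (U.pms L ι₁ V Γ) (U.cmAV F (inducedCMType k Φ₀)))
      (α : U.CohC (U.cmAV F (inducedCMType k Φ₀)) 1),
      α ∈ U.alphaLine F (inducedCMType k Φ₀) σ ∧ U.pullC G' 1 α = U.pullC G 1 α₀

/-- **Span-level inflation** on a universe (b01-idea-2, Sketch §3.3): `U_{(K₀,Φ₀)}(Γ)_{σ∘k} ⊆ U_{(F,Φ₀^F)}(Γ)_σ` — proved below for the model universe. [folklore] -/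
def Universe.UisoInflation (U : Universe) : Prop :=
  ∀ (K₀ F : CMField) (k : K₀ →+* F) (Φ₀ : CMType K₀) (σ : F →+* ℂ)
    {L : CMField} {ι₁ : L →+* ℂ} {V : HermSpace3 L ι₁} (Γ : Level V),
    U.Uiso Γ K₀ Φ₀ (σ.comp k) ≤ U.Uiso Γ F (inducedCMType k Φ₀) σ

/-- Generator-level inflation implies span-level inflation (b01-idea-2, Sketch §3.3). [folklore] -/
theorem Universe.uisoInflation_of_generatorInflation (U : Universe) (h : U.GeneratorInflation) :
    U.UisoInflation := by
  intro K₀ F k Φ₀ σ L ι₁ V Γ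
  refine Submodule.span_le.mpr ?_
  rintro ω ⟨G, α₀, hα₀, rfl⟩
  obtain ⟨G', α, hα, hG'⟩ := h K₀ F k Φ₀ σ Γ G α₀ hα₀
  exact Submodule.subset_span ⟨G', α, hα, hG'.symm⟩

namespace Model


/-- The chosen realisation of the code of `(K, Φ)` is an `IsCMTypeRealisation` of the coded type. -/
theorem isCMTypeRealisation_cmCode (h₃ : CMAbelianVarietyRealised) (K : CMField) (Φ : CMType K) :
    IsCMTypeRealisation (cmCode K Φ).Φ (cmRealisation h₃ (cmCode K Φ)).AV
      (cmRealisation h₃ (cmCode K Φ)).ι (cmRealisation h₃ (cmCode K Φ)).θ :=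
  ⟨(cmRealisation h₃ _).isSmoothProjective, (cmRealisation h₃ _).finrank_eq, (cmRealisation h₃ _).map_ι,
    fun σ' ↦ ⟨(cmRealisation h₃ _).finrank_eigenline σ', (cmRealisation h₃ _).hodgeType_of_mem σ',
      (cmRealisation h₃ _).hodgeType_of_not_mem σ'⟩⟩

/-- Membership in the coded CM type, read on the abstract field. -/
theorem mem_cmCode_Φ_iff (K : CMField) (Φ : CMType K) (τ : (cmCode K Φ).E →+* ℂ) :
    τ ∈ (cmCode K Φ).Φ.1 ↔ τ.comp (cmCodeEquiv K Φ).toRingHom ∈ Φ.1 := Iff.rfl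

/-- `U.eigenLine K Φ σ` of the model universe IS the `σ`-eigenline of the complexified rational action of the chosen
realisation, transported along `cmCodeEquiv K Φ` (`rfl`). -/
theorem universeOf_eigenLine_eq (hHD : exists_isReal_hodgeModel) (hI : hodgePQ_independent_of_hodgeModel)
    (hU : BallQuotientUniformisedDatum) (h₃ : CMAbelianVarietyRealised) (K : CMField) (Φ : CMType K) (σ : K →+* ℂ) :
    (universeOf hHD hI hU h₃).eigenLine K Φ σ =
      eigenline (complexify (cmAction ((cmRealisation h₃ (cmCode K Φ)).θ.comp (cmCodeEquiv K Φ).toRingHom)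
        ((cmRealisation h₃ (cmCode K Φ)).exists_map_comp (cmCodeEquiv K Φ)))) σ := rfl

/-- **`GeneratorInflation` holds on the model universe** `universeOf hHD hI hU h₃` (KERNEL over the rows (ii), (iii),
`hHD`, `hI` and the tree theorem `deligneMilne1982_Thm_6_20_full_holds`). -/
theorem universeOf_generatorInflation (hHD : exists_isReal_hodgeModel) (hI : hodgePQ_independent_of_hodgeModel)
    (hU : BallQuotientUniformisedDatum) (h₃ : CMAbelianVarietyRealised) :
    (universeOf hHD hI hU h₃).GeneratorInflation := by
  intro K₀ F k Φ₀ σ L ι₁ V Γ G α₀ hα₀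
  -- the two coded realisations and the single pull-back `s : A_{(K₀,Φ₀)} → A_{(F,Φ₀^F)}`
  have hΦ' : ∀ τ : (cmCode F (inducedCMType k Φ₀)).E →+* ℂ, τ ∈ (cmCode F (inducedCMType k Φ₀)).Φ.1 ↔
      (τ.comp (cmCodeEquiv F (inducedCMType k Φ₀)).toRingHom).comp k ∈ Φ₀.1 := fun τ ↦ by
    rw [mem_cmCode_Φ_iff, mem_inducedCMType_iff]
  obtain ⟨s, hs⟩ := exists_hom_eq_pull_of_mem_eigenline_coded k deligneMilne1982_Thm_6_20_full_holds hI
    (cmCodeEquiv K₀ Φ₀) (mem_cmCode_Φ_iff K₀ Φ₀) (isCMTypeRealisation_cmCode h₃ K₀ Φ₀)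
    ((cmRealisation h₃ (cmCode K₀ Φ₀)).exists_map_comp (cmCodeEquiv K₀ Φ₀))
    (cmCodeEquiv F (inducedCMType k Φ₀)) hΦ' (isCMTypeRealisation_cmCode h₃ F (inducedCMType k Φ₀))
    ((cmRealisation h₃ (cmCode F (inducedCMType k Φ₀))).exists_map_comp (cmCodeEquiv F (inducedCMType k Φ₀))) σ
  -- `G' := G ≫ s` as a morphism of the universe (`U.Mor` unfolds to scheme morphisms, `rfl`)
  let G' : (universeOf hHD hI hU h₃).Mor ((universeOf hHD hI hU h₃).pms L ι₁ V Γ)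
      ((universeOf hHD hI hU h₃).cmAV F (inducedCMType k Φ₀)) := G ≫ s
  have hcomp : ∀ α : (universeOf hHD hI hU h₃).CohC ((universeOf hHD hI hU h₃).cmAV F (inducedCMType k Φ₀)) 1,
      (universeOf hHD hI hU h₃).pullC G' 1 α =
        (universeOf hHD hI hU h₃).pullC G 1 ((pull s 1).baseChange ℂ α) := by
    intro α
    show (pull (G ≫ s) 1).baseChange ℂ α = (pull G 1).baseChange ℂ ((pull s 1).baseChange ℂ α)
    rw [pull_comp, LinearMap.baseChange_comp]
    rfl
  by_cases hσ : σ.comp k ∈ Φ₀.1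
  · -- `α₀ ∈ alphaLine = eigenLine` (M14), so `α₀ = (s^*)_ℂ α` with `α` a `σ`-eigenvector of `A_{(F,Φ₀^F)}`
    have hα₀' : α₀ ∈ (universeOf hHD hI hU h₃).eigenLine K₀ Φ₀ (σ.comp k) := by
      rw [← ((universeOf_fact_alphaLine hHD hI hU h₃) K₀ Φ₀ (σ.comp k)).1 hσ]; exact hα₀
    obtain ⟨α, hα, hpull⟩ := hs α₀ hα₀'
    have hσ' : σ ∈ (inducedCMType k Φ₀).1 := (mem_inducedCMType_iff k Φ₀ σ).2 hσ
    refine ⟨G', α, ?_, ?_⟩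
    · rw [((universeOf_fact_alphaLine hHD hI hU h₃) F (inducedCMType k Φ₀) σ).1 hσ']
      exact hα
    · rw [hcomp, hpull]
  · -- `alphaLine K₀ Φ₀ (σ ∘ k) = ⊥` (M14), so `α₀ = 0`
    have h0 : α₀ = 0 := by
      have := ((universeOf_fact_alphaLine hHD hI hU h₃) K₀ Φ₀ (σ.comp k)).2 hσ
      rw [this] at hα₀
      exact (Submodule.mem_bot ℂ).1 hα₀
    refine ⟨G', 0, Submodule.zero_mem _, ?_⟩
    rw [h0, map_zero, map_zero]

/-- `UisoInflation` on the model universe. -/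
theorem universeOf_uisoInflation (hHD : exists_isReal_hodgeModel) (hI : hodgePQ_independent_of_hodgeModel)
    (hU : BallQuotientUniformisedDatum) (h₃ : CMAbelianVarietyRealised) :
    (universeOf hHD hI hU h₃).UisoInflation :=
  (universeOf hHD hI hU h₃).uisoInflation_of_generatorInflation (universeOf_generatorInflation hHD hI hU h₃)

/-- `GeneratorInflation` on the end-state universe `picardCMUniverse hHD hI h₁ h₃` (`generatorInflation_rec` of
ROUTES-B01 §7). -/
theorem generatorInflation_rec (hHD : exists_isReal_hodgeModel) (hI : hodgePQ_independent_of_hodgeModel)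
    (h₁ : BallQuotientUniformised) (h₃ : CMAbelianVarietyRealised) :
    (picardCMUniverse hHD hI h₁ h₃).GeneratorInflation :=
  universeOf_generatorInflation hHD hI _ h₃

end Model

end Summit.HodgeConjecture.CorCM

end
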